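import Mathlib
import Summits.PneNP.PneNP.Theorems.ConvexRankGatesConvexGateBlindConditionalExpectation

/-!
# PneNP / ConvexRankGates — `ConvexGateBlind`: conditional positivity fails beyond `#H·(k−1) > m−1`

Helpers (`--supports stmt-PneNP-10680`), COLUMN-SPACE line (prover seat 2, session 16): the matching lower bound for
`…ConditionalExpectation.conditional_bichMass_nonneg` / the realisation lemma `…CondPositivity.negMass_hub_le`.

THEOREM (`conditional_bichMass_sharp`, stub). Let `4 ≤ k`, `2 ≤ q`, and let `H` be a vertex set with `k ≤ #Hᶜ` and
`m − 1 < #H·(k−1)`. Then for every colouring `c₀` that is CONSTANT on `H` there is a `k`-clique-non-negative edge weighting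
`w` whose total bichromatic mass over the extensions of `c₀|_H` is NEGATIVE:
`∑_{c : c|_H = c₀|_H} w(bich_c) < 0`, i.e. `E[w(bich_c) | c|_H monochromatic] < 0`.

The witness is the split weighting `w = 2k` inside `H`, `−1` on the cut `(H, Hᶜ)`, `2/(k−2)` inside `Hᶜ`: a `k`-set meeting `H`
in `a` vertices has weight `2k·a(a−1)/2 − a(k−a) + (k−a)(k−a−1)/(k−2) ≥ 0` (zero at `a = 1`), while, `H` being monochromatic,
only the pairs touching `Hᶜ` are ever bichromatic, each in a `(q−1)/q` fraction of the extensions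
(`…ConditionalExpectation.sum_extensions_ite_ne`), with total weight `(m−h)(m−h−1)/(k−2) − 2h(m−h) < 0` iff `m − 1 < h(k−1)`.
Together with the LP evidence of the session memo (conditional positivity holds for ALL valid weightings and ALL `c_H` iff
`#H ≤ ⌊(m−1)/(k−1)⌋` in every tested case) this locates the threshold of the realisation lemma at `#H·(k−1) ≤ m − 1` — the
fractional `K_k`-decomposition threshold of `K_m − K_h`. [new]
-/

set_option linter.dupNamespace false

namespace Summit.PneNP.PneNP.Theorems

open Finset Real Literature.Computability.Complexity
open Summit.PneNP.PneNP.Cruxes.ConvexGateBlind.StrictRankConicCover (Edge)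

noncomputable section

variable {m q : ℕ}

/-! ## The extension sum, evaluated -/

/-- **The total bichromatic mass over the extensions of a partial colouring (identity).** For `V` symmetric with zero
diagonal, `0 < q`, a vertex set `H` and a colouring `c₀`:
`∑_{c : c|_H = c₀|_H} ∑_{a,b} 𝟙[c a ≠ c b] V a b = #ext · (∑_{a,b ∈ H} 𝟙[c₀ a ≠ c₀ b] V a b + ((q−1)/q)(∑∑V − ∑_{H×H}V))`. [new] -/
theorem sum_extensions_bichMass_eq (hq : 0 < q) (V : Fin m → Fin m → ℝ) (hV : ∀ x y, V x y = V y x)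
    (hV0 : ∀ x, V x x = 0) (H : Finset (Fin m)) (c₀ : Fin m → Fin q) :
    ∑ c ∈ (Finset.univ : Finset (Fin m → Fin q)).filter (fun c => ∀ x ∈ H, c x = c₀ x),
        ∑ a, ∑ b, (if c a = c b then 0 else V a b) =
      ((((Finset.univ : Finset (Fin m → Fin q)).filter (fun c => ∀ x ∈ H, c x = c₀ x)).card : ℝ) *
        ((∑ a ∈ H, ∑ b ∈ H, (if c₀ a = c₀ b then 0 else V a b)) +
          ((q : ℝ) - 1) / q * ((∑ a, ∑ b, V a b) - ∑ a ∈ H, ∑ b ∈ H, V a b))) := by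
  classical
  set ext := (Finset.univ : Finset (Fin m → Fin q)).filter (fun c => ∀ x ∈ H, c x = c₀ x) with hext
  set N : ℝ := (ext.card : ℝ) with hN
  have hpair : ∀ a b : Fin m, ∑ c ∈ ext, (if c a = c b then 0 else V a b) =
      if a ∈ H ∧ b ∈ H then N * (if c₀ a = c₀ b then 0 else V a b) else (((q : ℝ) - 1) / q) * (N * V a b) := by
    intro a b
    by_cases hab : a = b
    · subst hab
      simp only [hV0, if_true]
      rw [Finset.sum_const_zero]
      split_ifs <;> simp
    by_cases h : a ∈ H ∧ b ∈ H
    · rw [if_pos h, hN, hext]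
      exact sum_extensions_ite_mem H c₀ h.1 h.2 (V a b)
    · rw [if_neg h]
      rcases not_and_or.1 h with ha | hb
      · rw [hN, hext]; exact sum_extensions_ite_ne hq H c₀ ha hab (V a b)
      · have hsym : ∑ c ∈ ext, (if c a = c b then (0 : ℝ) else V a b) = ∑ c ∈ ext, (if c b = c a then 0 else V b a) :=
          Finset.sum_congr rfl fun c _ => by rw [hV a b]; simp only [eq_comm]
        rw [hsym, hN, hext, hV a b]
        exact sum_extensions_ite_ne hq H c₀ hb (Ne.symm hab) (V b a)
  rw [Finset.sum_comm]
  have hswap : ∀ a : Fin m, ∑ c ∈ ext, ∑ b, (if c a = c b then (0 : ℝ) else V a b) =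
      ∑ b, ∑ c ∈ ext, (if c a = c b then (0 : ℝ) else V a b) := fun a => Finset.sum_comm
  simp_rw [hswap, hpair]
  have hsplit : ∀ a : Fin m, ∑ b, (if a ∈ H ∧ b ∈ H then N * (if c₀ a = c₀ b then 0 else V a b)
      else ((q : ℝ) - 1) / q * (N * V a b)) =
      ∑ b, (((q : ℝ) - 1) / q * (N * V a b)) +
        ∑ b, (if a ∈ H ∧ b ∈ H then N * (if c₀ a = c₀ b then 0 else V a b) - ((q : ℝ) - 1) / q * (N * V a b) else 0) := by
    intro a
    rw [← Finset.sum_add_distrib]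
    refine Finset.sum_congr rfl fun b _ => ?_
    split_ifs <;> ring
  simp_rw [hsplit]
  rw [Finset.sum_add_distrib, sum_sum_ite_mem_and H]
  simp only [Finset.sum_sub_distrib, ← Finset.mul_sum]
  ring

/-! ## The split weighting -/

/-- The SPLIT WEIGHTING of a vertex set `H` (as a matrix): `2k` inside `H`, `−1` across, `2/(k−2)` inside `Hᶜ`, `0` on the
diagonal. We phrase the lemmas for any `V` satisfying this description (no new definition). -/
theorem splitWeight_symm_of {k : ℕ} {H : Finset (Fin m)} {V : Fin m → Fin m → ℝ}
    (hVdef : ∀ x y, V x y = if x = y then 0 else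
      if x ∈ H then (if y ∈ H then 2 * (k : ℝ) else -1) else (if y ∈ H then -1 else 2 / ((k : ℝ) - 2)))
    (x y : Fin m) : V x y = V y x := by
  rw [hVdef x y, hVdef y x]
  by_cases hxy : x = y
  · subst hxy; rfl
  · rw [if_neg hxy, if_neg (Ne.symm hxy)]
    by_cases hx : x ∈ H <;> by_cases hy : y ∈ H <;> simp [hx, hy]

/-- **Row sums of the split weighting inside a vertex set.** For `x ∈ Q`: `∑_{y ∈ Q} split(x,y)` equals
`2k(a−1) − (#Q − a)` if `x ∈ H` and `−a + (#Q − a − 1)·2/(k−2)` if `x ∉ H`, where `a = #(Q ∩ H)`. [new] -/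
theorem sum_splitWeight_row {k : ℕ} {H : Finset (Fin m)} {V : Fin m → Fin m → ℝ}
    (hVdef : ∀ x y, V x y = if x = y then 0 else
      if x ∈ H then (if y ∈ H then 2 * (k : ℝ) else -1) else (if y ∈ H then -1 else 2 / ((k : ℝ) - 2)))
    (Q : Finset (Fin m)) {x : Fin m} (hx : x ∈ Q) :
    ∑ y ∈ Q, V x y =
      if x ∈ H then 2 * (k : ℝ) * (((Q.filter (· ∈ H)).card : ℝ) - 1) - ((Q.filter (· ∉ H)).card : ℝ)
      else -((Q.filter (· ∈ H)).card : ℝ) + (((Q.filter (· ∉ H)).card : ℝ) - 1) * (2 / ((k : ℝ) - 2)) := by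
  classical
  rw [← Finset.sum_filter_add_sum_filter_not Q (· ∈ H)]
  by_cases hxH : x ∈ H
  · rw [if_pos hxH]
    -- `y ∈ H`: value `2k` except at `y = x`
    have h1 : ∑ y ∈ Q.filter (· ∈ H), V x y = 2 * (k : ℝ) * (((Q.filter (· ∈ H)).card : ℝ) - 1) := by
      have hxin : x ∈ Q.filter (· ∈ H) := Finset.mem_filter.2 ⟨hx, hxH⟩
      rw [← Finset.add_sum_erase _ _ hxin, show V x x = 0 by rw [hVdef, if_pos rfl], zero_add]
      have : ∀ y ∈ (Q.filter (· ∈ H)).erase x, V x y = 2 * (k : ℝ) := by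
        intro y hy
        have hyx : y ≠ x := Finset.ne_of_mem_erase hy
        have hyH : y ∈ H := (Finset.mem_filter.1 (Finset.mem_of_mem_erase hy)).2
        rw [hVdef, if_neg (Ne.symm hyx), if_pos hxH, if_pos hyH]
      rw [Finset.sum_congr rfl this, Finset.sum_const, nsmul_eq_mul, Finset.card_erase_of_mem hxin,
        Nat.cast_sub (Finset.card_pos.2 ⟨x, hxin⟩), Nat.cast_one]
      ring
    -- `y ∉ H`: value `-1`
    have h2 : ∑ y ∈ Q.filter (· ∉ H), V x y = -((Q.filter (· ∉ H)).card : ℝ) := by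
      have : ∀ y ∈ Q.filter (· ∉ H), V x y = -1 := by
        intro y hy
        have hyH : y ∉ H := (Finset.mem_filter.1 hy).2
        have hyx : x ≠ y := fun h => hyH (h ▸ hxH)
        rw [hVdef, if_neg hyx, if_pos hxH, if_neg hyH]
      rw [Finset.sum_congr rfl this, Finset.sum_const, nsmul_eq_mul, mul_neg_one]
    rw [h1, h2]
    ring
  · rw [if_neg hxH]
    have h1 : ∑ y ∈ Q.filter (· ∈ H), V x y = -((Q.filter (· ∈ H)).card : ℝ) := by
      have : ∀ y ∈ Q.filter (· ∈ H), V x y = -1 := by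
        intro y hy
        have hyH : y ∈ H := (Finset.mem_filter.1 hy).2
        have hyx : x ≠ y := fun h => hxH (h ▸ hyH)
        rw [hVdef, if_neg hyx, if_neg hxH, if_pos hyH]
      rw [Finset.sum_congr rfl this, Finset.sum_const, nsmul_eq_mul, mul_neg_one]
    have h2 : ∑ y ∈ Q.filter (· ∉ H), V x y = (((Q.filter (· ∉ H)).card : ℝ) - 1) * (2 / ((k : ℝ) - 2)) := by
      have hxin : x ∈ Q.filter (· ∉ H) := Finset.mem_filter.2 ⟨hx, hxH⟩
      rw [← Finset.add_sum_erase _ _ hxin, show V x x = 0 by rw [hVdef, if_pos rfl], zero_add]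
      have : ∀ y ∈ (Q.filter (· ∉ H)).erase x, V x y = 2 / ((k : ℝ) - 2) := by
        intro y hy
        have hyx : y ≠ x := Finset.ne_of_mem_erase hy
        have hyH : y ∉ H := (Finset.mem_filter.1 (Finset.mem_of_mem_erase hy)).2
        rw [hVdef, if_neg (Ne.symm hyx), if_neg hxH, if_neg hyH]
      rw [Finset.sum_congr rfl this, Finset.sum_const, nsmul_eq_mul, Finset.card_erase_of_mem hxin,
        Nat.cast_sub (Finset.card_pos.2 ⟨x, hxin⟩), Nat.cast_one]
    rw [h1, h2]

/-- **The split weighting is `k`-clique-non-negative** (`4 ≤ k`): on a `k`-set meeting `H` in `a` vertices its double sum is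
`a(2k(a−1) − (k−a)) + (k−a)(−a + (k−a−1)·2/(k−2)) ≥ 0`. [new] -/
theorem splitWeight_valid {k : ℕ} (hk : 4 ≤ k) {H : Finset (Fin m)} {V : Fin m → Fin m → ℝ}
    (hVdef : ∀ x y, V x y = if x = y then 0 else
      if x ∈ H then (if y ∈ H then 2 * (k : ℝ) else -1) else (if y ∈ H then -1 else 2 / ((k : ℝ) - 2)))
    (Q : Finset (Fin m)) (hQ : Q.card = k) :
    0 ≤ ∑ x ∈ Q, ∑ y ∈ Q, V x y := by
  classical
  have hkR : (4 : ℝ) ≤ k := by exact_mod_cast hk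
  set a : ℝ := ((Q.filter (· ∈ H)).card : ℝ) with ha
  set b : ℝ := ((Q.filter (· ∉ H)).card : ℝ) with hb
  have hab : a + b = k := by
    rw [ha, hb, ← Nat.cast_add, Finset.card_filter_add_card_filter_not (s := Q) (fun x => x ∈ H), hQ]
  have ha0 : 0 ≤ a := Nat.cast_nonneg _
  have hb0 : 0 ≤ b := Nat.cast_nonneg _
  have hk2 : (0 : ℝ) < (k : ℝ) - 2 := by linarith
  -- evaluate the double sum
  have hrow := fun x (hx : x ∈ Q) => sum_splitWeight_row hVdef Q hx
  have hsum : ∑ x ∈ Q, ∑ y ∈ Q, V x y =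
      a * (2 * (k : ℝ) * (a - 1) - b) + b * (-a + (b - 1) * (2 / ((k : ℝ) - 2))) := by
    rw [Finset.sum_congr rfl hrow, ← Finset.sum_filter_add_sum_filter_not Q (· ∈ H)]
    have h1 : ∀ x ∈ Q.filter (· ∈ H), (if x ∈ H then 2 * (k : ℝ) * (a - 1) - b else -a + (b - 1) * (2 / ((k : ℝ) - 2))) =
        2 * (k : ℝ) * (a - 1) - b := fun x hx => if_pos (Finset.mem_filter.1 hx).2
    have h2 : ∀ x ∈ Q.filter (· ∉ H), (if x ∈ H then 2 * (k : ℝ) * (a - 1) - b else -a + (b - 1) * (2 / ((k : ℝ) - 2))) =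
        -a + (b - 1) * (2 / ((k : ℝ) - 2)) := fun x hx => if_neg (Finset.mem_filter.1 hx).2
    rw [Finset.sum_congr rfl h1, Finset.sum_congr rfl h2, Finset.sum_const, Finset.sum_const, nsmul_eq_mul, nsmul_eq_mul]
  rw [hsum]
  -- the integer `a` is `0`, `1`, or `≥ 2`
  have hcase : a = 0 ∨ a = 1 ∨ 2 ≤ a := by
    rcases Nat.lt_or_ge (Q.filter (· ∈ H)).card 2 with h | h
    · have h01 : (Q.filter (· ∈ H)).card = 0 ∨ (Q.filter (· ∈ H)).card = 1 := by omega
      rcases h01 with h0 | h1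
      · left; rw [ha, h0]; norm_num
      · right; left; rw [ha, h1]; norm_num
    · right; right; rw [ha]; exact_mod_cast h
  -- the last term is non-negative (`b` is a natural number)
  have hb1 : 0 ≤ b * (b - 1) * (2 / ((k : ℝ) - 2)) := by
    rcases Nat.eq_zero_or_pos (Q.filter (· ∉ H)).card with h | h
    · rw [hb, h]; norm_num
    · have hb1' : (1 : ℝ) ≤ b := by rw [hb]; exact_mod_cast h
      have : 0 ≤ b - 1 := by linarith
      exact mul_nonneg (mul_nonneg hb0 this) (div_nonneg (by norm_num) hk2.le)
  have hexpand : a * (2 * (k : ℝ) * (a - 1) - b) + b * (-a + (b - 1) * (2 / ((k : ℝ) - 2))) =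
      2 * a * ((k : ℝ) * (a - 1) - b) + b * (b - 1) * (2 / ((k : ℝ) - 2)) := by ring
  rw [hexpand]
  rcases hcase with h0 | h1 | h2
  · -- `a = 0`
    rw [h0]; simp only [mul_zero, zero_mul, zero_add]; exact hb1
  · -- `a = 1`: `b = k - 1` and the expression is `-2(k-1) + (k-1)(k-2)·2/(k-2) = 0`
    rw [h1] at hab ⊢
    have hbk : b = k - 1 := by linarith
    rw [hbk]
    have : 2 * (1 : ℝ) * ((k : ℝ) * (1 - 1) - ((k : ℝ) - 1)) + ((k : ℝ) - 1) * ((k : ℝ) - 1 - 1) * (2 / ((k : ℝ) - 2)) = 0 := by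
      field_simp
      ring
    rw [this]
  · -- `a ≥ 2`: `k(a-1) - b ≥ k(a-1) - k = k(a-2) ≥ 0`
    have hbk : b ≤ k := by linarith
    have hX : 0 ≤ (k : ℝ) * (a - 1) - b := by
      have : 0 ≤ (k : ℝ) * (a - 2) := mul_nonneg (by linarith) (by linarith)
      nlinarith
    have hmain : 0 ≤ 2 * a * ((k : ℝ) * (a - 1) - b) := mul_nonneg (mul_nonneg (by norm_num) ha0) hX
    linarith

/-! ## Sharpness -/

/-- **Conditional positivity fails beyond `#H·(k−1) > m − 1`.** For `4 ≤ k`, `2 ≤ q`, a vertex set `H` with `k ≤ #Hᶜ` and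
`m − 1 < #H·(k−1)`, and a colouring `c₀` constant on `H`, there is a `k`-clique-non-negative edge weighting `w` of `K_m` with
`∑_{c : c|_H = c₀|_H} ∑_{e bichromatic in c} w(e) < 0`. [new] -/
theorem exists_valid_sum_extensions_colorVec_neg {k : ℕ} (hq : 2 ≤ q) (hk : 4 ≤ k) (H : Finset (Fin m))
    (hS : k ≤ (Hᶜ).card) (hbig : (m : ℝ) - 1 < H.card * ((k : ℝ) - 1)) (c₀ : Fin m → Fin q)
    (hc₀ : ∀ a ∈ H, ∀ b ∈ H, c₀ a = c₀ b) :
    ∃ w : Edge m → ℝ, (∀ Q ∈ (Finset.univ : Finset (Fin m)).powersetCard k, 0 ≤ softWindow w Q) ∧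
      ∑ c ∈ (Finset.univ : Finset (Fin m → Fin q)).filter (fun c => ∀ x ∈ H, c x = c₀ x),
        ∑ e, (if colorVec c e = true then w e else 0) < 0 := by
  classical
  have hqpos : 0 < q := by omega
  have hkR : (4 : ℝ) ≤ k := by exact_mod_cast hk
  obtain ⟨V, hVdef⟩ : ∃ V : Fin m → Fin m → ℝ, ∀ x y, V x y = if x = y then 0 else
      if x ∈ H then (if y ∈ H then 2 * (k : ℝ) else -1) else (if y ∈ H then -1 else 2 / ((k : ℝ) - 2)) :=
    ⟨fun x y => if x = y then 0 else
      if x ∈ H then (if y ∈ H then 2 * (k : ℝ) else -1) else (if y ∈ H then -1 else 2 / ((k : ℝ) - 2)), fun x y => rfl⟩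
  have hVsym : ∀ x y, V x y = V y x := splitWeight_symm_of hVdef
  have hV0 : ∀ x, V x x = 0 := fun x => by rw [hVdef, if_pos rfl]
  -- the edge weighting
  set w : Edge m → ℝ := fun e => Sym2.lift ⟨V, hVsym⟩ e.1 with hw
  have hVoff : ∀ (x y : Fin m) (h : x ≠ y), V x y = w ⟨s(x, y), CliqueExtLowerBound.Negative.mk_mem_edgeSet_top h⟩ := by
    intro x y _
    simp only [hw, Sym2.lift_mk]
  refine ⟨w, fun Q hQ => ?_, ?_⟩
  · rw [softWindow_eq_half_sum_sum w V hV0 hVoff Q]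
    exact div_nonneg (splitWeight_valid hk hVdef Q (Finset.mem_powersetCard.1 hQ).2) (by norm_num)
  · -- the extension sum in matrix form
    have hbich : ∀ c : Fin m → Fin q, ∑ e, (if colorVec c e = true then w e else 0) =
        (∑ x, ∑ y, if c x = c y then 0 else V x y) / 2 := by
      intro c
      refine sum_edge_eq_half_sum_sum _ _ (fun x => by rw [if_pos rfl]) (fun x y h => ?_)
      by_cases hc : c x = c y
      · rw [if_pos hc, if_neg]
        rw [(colorVec_mk_eq_false_iff c _).2 hc]
        exact Bool.false_ne_true
      · rw [if_neg hc, hVoff x y h, if_pos]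
        cases hcv : colorVec c ⟨s(x, y), CliqueExtLowerBound.Negative.mk_mem_edgeSet_top h⟩
        · exact absurd ((colorVec_mk_eq_false_iff c _).1 hcv) hc
        · rfl
    simp_rw [hbich]
    rw [← Finset.sum_div, sum_extensions_bichMass_eq hqpos V hVsym hV0 H c₀]
    refine div_neg_of_neg_of_pos (mul_neg_of_pos_of_neg ?_ ?_) (by norm_num)
    · -- `c₀` itself is an extension
      have : c₀ ∈ (Finset.univ : Finset (Fin m → Fin q)).filter (fun c => ∀ x ∈ H, c x = c₀ x) :=
        Finset.mem_filter.2 ⟨Finset.mem_univ _, fun x _ => rfl⟩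
      exact_mod_cast Finset.card_pos.2 ⟨c₀, this⟩
    · -- inside `H` nothing is bichromatic; outside, the mass is `(m-h)(m-h-1)·2/(k-2) - 2h(m-h) < 0`
      have hin : ∑ a ∈ H, ∑ b ∈ H, (if c₀ a = c₀ b then 0 else V a b) = 0 :=
        Finset.sum_eq_zero fun a ha => Finset.sum_eq_zero fun b hb => if_pos (hc₀ a ha b hb)
      rw [hin, zero_add]
      have hq1 : 0 < ((q : ℝ) - 1) / q := by
        have : (2 : ℝ) ≤ q := by exact_mod_cast hq
        exact div_pos (by linarith) (by linarith)
      -- the outside mass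
      have hout : (∑ a, ∑ b, V a b) - ∑ a ∈ H, ∑ b ∈ H, V a b =
          ∑ x ∈ Hᶜ, ∑ y ∈ Hᶜ, V x y + 2 * ∑ a ∈ H, ∑ y ∈ Hᶜ, V a y := by
        have := massOut_eq V hVsym H
        linarith
      have hHc : ∀ {y}, y ∈ Hᶜ ↔ y ∉ H := fun {y} => Finset.mem_compl
      have h1 : ∑ x ∈ Hᶜ, ∑ y ∈ Hᶜ, V x y = ((Hᶜ).card : ℝ) * ((((Hᶜ).card : ℝ) - 1) * (2 / ((k : ℝ) - 2))) := by
        have : ∀ x ∈ Hᶜ, ∑ y ∈ Hᶜ, V x y = (((Hᶜ).card : ℝ) - 1) * (2 / ((k : ℝ) - 2)) := by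
          intro x hx
          have hrow := sum_splitWeight_row hVdef Hᶜ hx
          rw [if_neg (hHc.1 hx)] at hrow
          rw [hrow]
          have hf0 : ((Hᶜ).filter (· ∈ H)).card = 0 := by
            rw [Finset.card_eq_zero, Finset.filter_eq_empty_iff]
            intro y hy; exact hHc.1 hy
          have hf1 : (Hᶜ).filter (· ∉ H) = Hᶜ := by
            ext y; simp [Finset.mem_filter]
          rw [hf0, hf1, Nat.cast_zero, neg_zero, zero_add]
        rw [Finset.sum_congr rfl this, Finset.sum_const, nsmul_eq_mul]
      have h2 : ∑ a ∈ H, ∑ y ∈ Hᶜ, V a y = -((H.card : ℝ) * ((Hᶜ).card : ℝ)) := by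
        have : ∀ a ∈ H, ∑ y ∈ Hᶜ, V a y = -((Hᶜ).card : ℝ) := by
          intro a ha
          have : ∀ y ∈ Hᶜ, V a y = -1 := by
            intro y hy
            have hyH : y ∉ H := hHc.1 hy
            have hay : a ≠ y := fun h => hyH (h ▸ ha)
            rw [hVdef, if_neg hay, if_pos ha, if_neg hyH]
          rw [Finset.sum_congr rfl this, Finset.sum_const, nsmul_eq_mul, mul_neg_one]
        rw [Finset.sum_congr rfl this, Finset.sum_const, nsmul_eq_mul]
        ring
      rw [hout, h1, h2]
      -- sizes
      have hSc : ((Hᶜ).card : ℝ) = (m : ℝ) - H.card := by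
        rw [Finset.card_compl, Fintype.card_fin, Nat.cast_sub (H.card_le_univ.trans_eq (Fintype.card_fin m))]
      have hSk : (k : ℝ) ≤ (Hᶜ).card := by exact_mod_cast hS
      have hk2 : (0 : ℝ) < (k : ℝ) - 2 := by linarith
      have hneg : ((Hᶜ).card : ℝ) * ((((Hᶜ).card : ℝ) - 1) * (2 / ((k : ℝ) - 2))) +
          2 * -((H.card : ℝ) * ((Hᶜ).card : ℝ)) < 0 := by
        have hSpos : (0 : ℝ) < (Hᶜ).card := by linarith
        -- `(s-1)·2/(k-2) < 2h` iff `s - 1 < h(k-2)` iff (with `s = m - h`) `m - 1 < h(k-1)`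
        have hlt : (((Hᶜ).card : ℝ) - 1) * (2 / ((k : ℝ) - 2)) < 2 * H.card := by
          rw [← mul_div_assoc, div_lt_iff₀ hk2]
          rw [hSc]
          nlinarith
        nlinarith
      exact mul_neg_of_pos_of_neg hq1 hneg

/-- **Conditional positivity fails beyond `#H·(k−1) > m − 1`** (registered form of
`exists_valid_sum_extensions_colorVec_neg`). [new] -/
theorem conditional_bichMass_sharp : ∀ {m q k : ℕ}, 2 ≤ q → 4 ≤ k → ∀ (H : Finset (Fin m)), k ≤ (Hᶜ).card → (m : ℝ) - 1 < H.card * ((k : ℝ) - 1) → ∀ (c₀ : Fin m → Fin q), (∀ a ∈ H, ∀ b ∈ H, c₀ a = c₀ b) → ∃ w : Edge m → ℝ, (∀ Q ∈ (Finset.univ : Finset (Fin m)).powersetCard k, 0 ≤ softWindow w Q) ∧ ∑ c ∈ (Finset.univ : Finset (Fin m → Fin q)).filter (fun c => ∀ x ∈ H, c x = c₀ x), ∑ e, (if colorVec c e = true then w e else 0) < 0 :=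
  fun hq hk H hS hbig c₀ hc₀ => exists_valid_sum_extensions_colorVec_neg hq hk H hS hbig c₀ hc₀

end

end Summit.PneNP.PneNP.Theorems
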